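import Literature.NumberTheory.EllipticCurves.FanWan2023.NonsplitRubinLFunctionFrame
import Summits.BirchSwinnertonDyer.Rank1Residual.X11b.Three.LambdaSupplyTwistSupply
import Mathlib.Analysis.Analytic.IsolatedZeros
import Mathlib.Analysis.Analytic.OfScalars

/-! # Route `CongruentShaFreeCut` (rung S2) — crux `RankPosOfTwoSelmerCorankOne`
(stmt-BirchSwinnertonDyer-19079, the route's declared RESIDUAL conjunct), line `fw-ramified-tower`:
Fan–Wan v2 Prop 3.6 `\ref{Int}` + Def 5.23 `\ref{pLf}` AT THE TRIVIAL CHARACTER `φ₀`, and RIGIDITY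
of the frame `FanWan2023.IsNonsplitRubinLFunction` — the two kernel-checkable facts about the typed
Prop-Int predicate that Fan–Wan's `p`-converse (Thm 6.9 `\ref{main proposition}`) consumes

Cell `bsd-cn100`, seat `bsd-cn100-transfer-2` g2 (D-0074 row (I): «the FW v2 Prop-Int statement at
the ramified prime 2 as the BC3 stub of 19079's skeleton»). THEOREMS ONLY over the landed frame
`Literature/NumberTheory/EllipticCurves/FanWan2023/NonsplitRubinLFunctionFrame.lean` (p419865; this
seat's D2): no definition, no named fact, no `sorry`; valid at every prime `p` (so at `p = 2`) and
every number field `K` (so at `K = ℚ(i)`). Nothing of Fan–Wan is ASSERTED: every statement is of the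
form "IF `L` satisfies the interpolation predicate THEN …".

## Why (the place of Prop \ref{Int} in the `p`-converse, FanWan_v2.tex l.2204–2224)

In the proof of Thm 6.9 the anticyclotomic `p`-adic `L`-functions enter three times: `𝓛•_ψ` as the
generator of `char(X⁻_ψ)` (Cor. 6.4 `\ref{AIMC}`, (imc)), inside the length identity (vhf) of the
virtual Heegner family, and `𝓛°_{ξχ^c}` through `ord_P(𝓛°_{ξχ^c}) = 0` at `P = (X)` — "Here for the
last identity, we use `L(ξχ^c, 1) ≠ 0`" (l.2219), i.e. Def 5.23: "the origin point `φ₀` IS an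
interpolation point" (l.1958) + Prop 3.6 + the non-vanishing of the central value. The first two
uses CANCEL in the count (PRCJ) and live on `Λ`-adic Selmer modules the tree does not have; the third
is a statement about the VALUE OF `L` AT `X = 0`, which the tree can check. §3 below proves it:
`constantCoeff L = ι⁻¹(C 0 𝟙 · L(ψ, s₀)/Ω_∞) · Ω_p`, hence (constants and periods non-zero)
`L(φ₀) ≠ 0 ↔ L(ψ, s₀) ≠ 0` — in particular `ord_{X=0} 𝓛°_{ψ'} = 0` for the auxiliary `ψ' = ξχ^c`
(root number `+1`), and `X ∣ 𝓛•_ψ` for the sign-`−1` character itself. §1–§2 prove the RIGIDITY of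
the frame: a `DiscSeries` convergent on a disc is determined by its values along any sequence of
points accumulating at `0`, so two witnesses of `IsNonsplitRubinLFunction` with the SAME constant
system and periods coincide, given a supply of arithmetic points `x_k → 0` (the characters
`χ₀^{p^k}`-type; the tree constructs no Hecke characters of prescribed infinity type, so the supply is
a hypothesis, exactly as in the b2b cell's `X11b.isBDPLFunction_unique_of_tendsto`). This is what
makes the frame's "constant system `C` is a PARAMETER" honest: AT FIXED `(C, Ω_∞, Ω_p)` the predicate
speaks about ONE series; with `C` quantified existentially it would not (junk `u·L`, `u(0) ≠ 0` —
recorded in the skeleton `fw-ramified-tower` v2 and the seat's NOTES).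

## What this file proves

* §1 `hasValueAt_sub`, **`eq_zero_of_hasValueAt_zero_frequently`** — identity principle at `0` for
  `DiscSeries p = ℂ_p⟦X⟧` with a positive radius (one convergence point `x₀ ≠ 0` suffices): a series
  vanishing along `x_k → 0`, `x_k ≠ 0` frequently, is `0` (Mathlib's principle of isolated zeros
  `AnalyticAt.frequently_zero_iff_eventually_zero` + `HasFPowerSeriesAt.eq_zero`; no boundedness of
  coefficients needed, unlike `R₀⟦T⟧`). **`eq_of_hasValueAt_frequently`**,
  **`eq_of_convergesOnBall_of_hasValueAt`** — two series with common values along such a sequence are equal.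
* §2 **`isNonsplitRubinLFunction_unique_of_tendsto`** — frame rigidity at fixed `(C, Ω_∞, Ω_p)`;
  `isNonsplitRubinLFunction_forall_of_exists_of_tendsto` ("some witness has `P`" = "every witness has `P`").
* §3 **`hasValueAt_origin`**, **`constantCoeff_eq_of_isNonsplitRubinLFunction`**,
  **`constantCoeff_ne_zero_iff`**, `constantCoeff_ne_zero_of_centralValue_ne_zero`,
  `constantCoeff_eq_zero_of_centralValue_eq_zero` — Prop \ref{Int} at `φ₀` (`k = 0`, `χ = 𝟙`, avatar
  the trivial character `e ∘ 1`, point `X = 0`).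

Supports, does not close, stmt-BirchSwinnertonDyer-19079 (helper lemmas of the line `fw-ramified-tower`;
`stub_originNonvanishing` of the v2 skeleton is `constantCoeff_ne_zero_of_centralValue_ne_zero`).
PARTITION: none (RANK axis). BSD is not touched by any of this.

References: [FanWan2023] Prop. 3.6 (l.1515–1528), Def. 5.23 (l.1957–1960), Thm. 6.9 proof
(l.2209–2224); [Cassels1986] Ch. 4 Thm. 4.1 (Strassmann; here the accumulation variant via isolated
zeros); tree: `X11b.BDPFrameUniqueness` (the `R₀⟦T⟧` twin), `X11b.Three.LambdaSupply.isPAdicAvatarOf_one`. -/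

noncomputable section

open scoped Topology ENNReal NNReal
open Filter NumberField IsDedekindDomain Field PowerSeries
open Literature.NumberTheory.GaloisRepresentations Literature.NumberTheory.EllipticCurves
open Literature.NumberTheory.EllipticCurves.FanWan2023
open Summit.BirchSwinnertonDyer.Rank1Residual.X11b.Three.LambdaSupply

namespace Summit.BirchSwinnertonDyer.BirchSwinnertonDyer.Theorems.CongruentShaFreeCutPropIntAtOrigin

universe u

variable {p : ℕ} [Fact p.Prime]

/-! ### §1. Identity principle at `0` for `DiscSeries p = ℂ_p⟦X⟧` -/

section Identity

/-- Values of a difference: if `L(x) = v` and `L'(x) = v'` then `(L − L')(x) = v − v'`. [folklore] -/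
theorem hasValueAt_sub {L L' : DiscSeries p} {x v v' : ℂ_[p]} (h : L.HasValueAt x v)
    (h' : L'.HasValueAt x v') : (L - L').HasValueAt x (v - v') := by
  refine (HasSum.sub h h').congr_fun fun n ↦ ?_
  simp only [map_sub, sub_mul]

/-- **Identity principle at `0` for power series over `ℂ_p` with a positive radius.** If
`L ∈ ℂ_p⟦X⟧` has a value at some `x₀ ≠ 0` (so its radius of convergence is `≥ ‖x₀‖ > 0`) and
`L(x_k) = 0` for infinitely many terms of a sequence `x_k → 0` with `x_k ≠ 0`, then `L = 0`: the sum
is analytic on the ball of radius `‖x₀‖`, vanishes frequently on the punctured neighbourhood of `0`,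
hence near `0` (isolated zeros), so its series at `0` is zero. The `R₀⟦T⟧` version (bounded
coefficients) is the tree's `X11b.eq_zero_of_norm_le_of_hasSum_zero_of_tendsto_zero`.
[cite: Cassels1986, Ch. 4 Thm. 4.1 (Strassmann; accumulation variant via isolated zeros)] -/
theorem eq_zero_of_hasValueAt_zero_frequently {L : DiscSeries p} {x₀ v₀ : ℂ_[p]} (hx₀ : x₀ ≠ 0)
    (h₀ : L.HasValueAt x₀ v₀) {x : ℕ → ℂ_[p]} (hx : Tendsto x atTop (𝓝 0))
    (hfreq : ∃ᶠ k in atTop, x k ≠ 0 ∧ L.HasValueAt (x k) 0) : L = 0 := by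
  set c : ℕ → ℂ_[p] := fun n ↦ PowerSeries.coeff n L with hc_def
  let P : FormalMultilinearSeries ℂ_[p] ℂ_[p] ℂ_[p] := FormalMultilinearSeries.ofScalars ℂ_[p] c
  -- radius ≥ ‖x₀‖ from the convergence at `x₀`
  have hterms : Tendsto (fun n ↦ ‖P n‖ * (‖x₀‖₊ : ℝ) ^ n) atTop (𝓝 0) := by
    have h1 : Tendsto (fun n ↦ c n * x₀ ^ n) atTop (𝓝 0) := h₀.summable.tendsto_atTop_zero
    have h2 := h1.norm
    rw [norm_zero] at h2
    refine h2.congr fun n ↦ ?_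
    rw [norm_mul, norm_pow, FormalMultilinearSeries.ofScalars_norm, coe_nnnorm]
  have hrad : ((‖x₀‖₊ : ℝ≥0) : ℝ≥0∞) ≤ P.radius := P.le_radius_of_tendsto hterms
  have hpos : 0 < P.radius :=
    lt_of_lt_of_le (ENNReal.coe_pos.2 (nnnorm_pos.2 hx₀)) hrad
  have hP : HasFPowerSeriesOnBall P.sum P 0 P.radius := P.hasFPowerSeriesOnBall hpos
  -- the sum vanishes at every `x_k` with `‖x_k‖ < ‖x₀‖` where `L(x_k) = 0`
  have hval : ∀ k, ‖x k‖ < ‖x₀‖ → L.HasValueAt (x k) 0 → P.sum (x k) = 0 := by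
    intro k hk hk0
    have hy : x k ∈ Metric.eball (0 : ℂ_[p]) P.radius := by
      refine lt_of_lt_of_le ?_ hrad
      rw [edist_zero_right, enorm_eq_nnnorm, ENNReal.coe_lt_coe]
      exact_mod_cast hk
    have h1 : HasSum (fun n ↦ P n fun _ ↦ x k) (P.sum (x k)) := by
      simpa only [zero_add] using hP.hasSum hy
    have h2 : HasSum (fun n ↦ P n fun _ ↦ x k) 0 := by
      have hfun : (fun n ↦ P n fun _ ↦ x k) = fun n ↦ c n * x k ^ n := by
        funext n
        rw [FormalMultilinearSeries.ofScalars_apply_eq, smul_eq_mul]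
      rw [hfun]
      exact hk0
    exact h1.unique h2
  have hev1 : ∀ᶠ k in atTop, ‖x k‖ < ‖x₀‖ := by
    have hball : Metric.ball (0 : ℂ_[p]) ‖x₀‖ ∈ 𝓝 (0 : ℂ_[p]) :=
      Metric.ball_mem_nhds 0 (norm_pos_iff.2 hx₀)
    filter_upwards [hx.eventually hball] with k hk
    simpa [Metric.mem_ball, dist_zero_right] using hk
  have hfreq' : ∃ᶠ k in atTop, P.sum (x k) = 0 ∧ x k ∈ ({0}ᶜ : Set ℂ_[p]) := by
    refine (hfreq.and_eventually hev1).mono ?_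
    rintro k ⟨⟨hk0, hkL⟩, hk1⟩
    exact ⟨hval k hk1 hkL, hk0⟩
  have hfreq'' : ∃ᶠ z in 𝓝[≠] (0 : ℂ_[p]), P.sum z = 0 := by
    rw [frequently_nhdsWithin_iff]
    exact hx.frequently hfreq'
  -- isolated zeros
  have hev : ∀ᶠ z in 𝓝 (0 : ℂ_[p]), P.sum z = 0 :=
    hP.analyticAt.frequently_zero_iff_eventually_zero.mp hfreq''
  have h0 : HasFPowerSeriesAt (0 : ℂ_[p] → ℂ_[p]) P 0 :=
    hP.hasFPowerSeriesAt.congr (hev.mono fun z hz ↦ by rw [hz, Pi.zero_apply])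
  have hP0 : P = 0 := h0.eq_zero
  have hc0 : c = 0 := (FormalMultilinearSeries.ofScalars_series_eq_zero ℂ_[p]).mp hP0
  ext n
  have hn := congrFun hc0 n
  rw [hc_def] at hn
  simpa using hn

/-- **Two power series over `ℂ_p` with a common convergence point `x₀ ≠ 0` and common values
`L(x_k) = L'(x_k)` along infinitely many terms of a sequence `x_k → 0`, `x_k ≠ 0`, are EQUAL.**
[cite: Cassels1986, Ch. 4 Thm. 4.1 (Strassmann; accumulation variant via isolated zeros)] -/
theorem eq_of_hasValueAt_frequently {L L' : DiscSeries p} {x₀ v₀ v₀' : ℂ_[p]} (hx₀ : x₀ ≠ 0)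
    (h₀ : L.HasValueAt x₀ v₀) (h₀' : L'.HasValueAt x₀ v₀') {x v : ℕ → ℂ_[p]}
    (hx : Tendsto x atTop (𝓝 0))
    (hfreq : ∃ᶠ k in atTop, x k ≠ 0 ∧ L.HasValueAt (x k) (v k) ∧ L'.HasValueAt (x k) (v k)) :
    L = L' := by
  have hsub : L - L' = 0 := by
    refine eq_zero_of_hasValueAt_zero_frequently hx₀ (hasValueAt_sub h₀ h₀') hx ?_
    refine hfreq.mono ?_
    rintro k ⟨hk0, hk, hk'⟩
    refine ⟨hk0, ?_⟩
    have := hasValueAt_sub hk hk'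
    rwa [sub_self] at this
  exact sub_eq_zero.mp hsub

/-- **Two `DiscSeries` convergent on the disc `‖X‖ < ρ` (`ρ > 0`) with common values along a
sequence `x_k → 0`, `x_k ≠ 0` frequently, are EQUAL** (a point `0 < ‖x₀‖ < ρ` exists because the
value group of `ℂ_p` is dense, `NormedField.exists_norm_lt`).
[cite: Cassels1986, Ch. 4 Thm. 4.1 (Strassmann; accumulation variant via isolated zeros)] -/
theorem eq_of_convergesOnBall_of_hasValueAt {L L' : DiscSeries p} {ρ : ℝ} (hρ : 0 < ρ)
    (hL : L.ConvergesOnBall ρ) (hL' : L'.ConvergesOnBall ρ) {x v : ℕ → ℂ_[p]}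
    (hx : Tendsto x atTop (𝓝 0)) (hne : ∃ᶠ k in atTop, x k ≠ 0)
    (hv : ∀ k, L.HasValueAt (x k) (v k)) (hv' : ∀ k, L'.HasValueAt (x k) (v k)) : L = L' := by
  obtain ⟨x₀, hx₀pos, hx₀lt⟩ := NormedField.exists_norm_lt ℂ_[p] hρ
  obtain ⟨v₀, h₀⟩ := hL x₀ hx₀lt
  obtain ⟨v₀', h₀'⟩ := hL' x₀ hx₀lt
  exact eq_of_hasValueAt_frequently (norm_pos_iff.1 hx₀pos) h₀ h₀' hx
    (hne.mono fun k hk ↦ ⟨hk, hv k, hv' k⟩)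

end Identity

/-! ### §2. Rigidity of the frame `IsNonsplitRubinLFunction` at fixed constants and periods -/

section Frame

variable {K : Type u} [Field K] [NumberField K] {ι : PadicAlgCl p ≃+* ℂ} {κac : ZpExtension K p}
  {γ : absoluteGaloisGroup K} {ψ : HeckeCharacter K} {s₀ : ℂ} {m : ℕ}
  {C : ℕ → HeckeCharacter K → ℂ} {Ωinf : ℂ} {Ωp : ℂ_[p]}

/-- **Frame rigidity at fixed `(C, Ω_∞, Ω_p)`** (Fan–Wan v2 Prop 3.6 + Def 5.23 read as the tree's
predicate `IsNonsplitRubinLFunction ι κ⁻ γ ψ s₀ m C Ω_∞ Ω_p ·`): two series `L, L' ∈ ℂ_p⟦X⟧`, both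
convergent on `‖X‖ < p^{−m}` and both with the interpolation property for the SAME constant system
and periods, are EQUAL — provided a SUPPLY of arithmetic points of `𝔛₁` accumulating at `φ₀`: Hecke
characters `χ_k` unramified outside `p`, of infinity type `(n_k, −n_k)` with `2(p²−1) ∣ n_k`, with
entire `L(ψχ_k, s)` (binder) and `p`-adic avatars `r_k` through `κ⁻`, whose points
`x_k = r_k(γ) − 1 → 0` with `x_k ≠ 0` infinitely often (in nature: `χ₀^{p^j}` for one arithmetic
`χ₀`; the tree constructs no such characters, so the supply is a hypothesis, as in
`X11b.isBDPLFunction_unique_of_tendsto`). Both series take the prescribed value at every `x_k` in the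
disc; `eq_of_convergesOnBall_of_hasValueAt` on the tail. Different `(C, Ω_∞, Ω_p)` are NOT compared.
[claim: FanWan2023, status: under-review] [cite: FanWan2023, Prop. 3.6 (l.1515–1528) and Def. 5.23 (l.1957–1960)] -/
theorem isNonsplitRubinLFunction_unique_of_tendsto {L L' : DiscSeries p}
    (hL : IsNonsplitRubinLFunction ι κac γ ψ s₀ m C Ωinf Ωp L)
    (hL' : IsNonsplitRubinLFunction ι κac γ ψ s₀ m C Ωinf Ωp L')
    (hconv : L.ConvergesOnBall ((p : ℝ) ^ (-(m : ℤ))))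
    (hconv' : L'.ConvergesOnBall ((p : ℝ) ^ (-(m : ℤ))))
    {χ : ℕ → HeckeCharacter K} {n : ℕ → ℕ} {r : ℕ → FramedGaloisRep K (PadicAlgCl p) 1}
    (hn : ∀ k, 2 * (p ^ 2 - 1) ∣ n k)
    (hunr : ∀ k (w : HeightOneSpectrum (𝓞 K)), ((p : ℕ) : 𝓞 K) ∉ w.asIdeal → (χ k).IsUnramifiedAt w)
    (hinf : ∀ k, (χ k).HasInfinityType (fun _ ↦ (n k : ℤ)) (fun _ ↦ -(n k : ℤ)))
    (hc : ∀ k, LFunction.HasEntireContinuation (heckeLFunction (ψ * χ k)))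
    (hr : ∀ k, IsPAdicAvatarOf ι (χ k) (r k)) (hκ : ∀ k, FactorsThroughZp κac (r k))
    (hlim : Tendsto (fun k ↦ avatarValueAt (r k) γ) atTop (𝓝 1))
    (hne : ∃ᶠ k in atTop, avatarValueAt (r k) γ ≠ 1) : L = L' := by
  have hρ : (0 : ℝ) < (p : ℝ) ^ (-(m : ℤ)) := zpow_pos (Nat.cast_pos.2 (Fact.out : p.Prime).pos) _
  obtain ⟨x₀, hx₀pos, hx₀lt⟩ := NormedField.exists_norm_lt ℂ_[p] hρ
  obtain ⟨v₀, h₀⟩ := hconv x₀ hx₀lt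
  obtain ⟨v₀', h₀'⟩ := hconv' x₀ hx₀lt
  have hx : Tendsto (fun k ↦ avatarValueAt (r k) γ - 1) atTop (𝓝 0) := by
    rw [← sub_self (1 : ℂ_[p])]
    exact hlim.sub_const 1
  -- eventually the points lie in the disc of interpolation
  have hdisc : ∀ᶠ k in atTop, ‖avatarValueAt (r k) γ - 1‖ < (p : ℝ) ^ (-(m : ℤ)) := by
    have hball : Metric.ball (0 : ℂ_[p]) ((p : ℝ) ^ (-(m : ℤ))) ∈ 𝓝 (0 : ℂ_[p]) :=
      Metric.ball_mem_nhds 0 hρ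
    filter_upwards [hx.eventually hball] with k hk
    simpa [Metric.mem_ball, dist_zero_right] using hk
  refine eq_of_hasValueAt_frequently (norm_pos_iff.1 hx₀pos) h₀ h₀' hx
    (v := fun k ↦ ((ι.symm (C (n k) (χ k) * (hc k).continuation s₀ / Ωinf ^ (2 * n k + 1)) :
      PadicAlgCl p) : ℂ_[p]) * Ωp ^ (2 * n k + 1)) ?_
  refine ((hne.mono fun k hk ↦ sub_ne_zero.mpr hk).and_eventually hdisc).mono ?_
  rintro k ⟨hk0, hkd⟩
  exact ⟨hk0, hL (χ k) (n k) (hn k) (hunr k) (hinf k) (hc k) (r k) (hr k) (hκ k) hkd,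
    hL' (χ k) (n k) (hn k) (hunr k) (hinf k) (hc k) (r k) (hr k) (hκ k) hkd⟩

/-- **At fixed `(C, Ω_∞, Ω_p)`, "some witness of the frame has `P`" = "every witness has `P`"**
(under the supply hypothesis of `isNonsplitRubinLFunction_unique_of_tendsto`, among series
convergent on the disc). [claim: FanWan2023, status: under-review]
[cite: FanWan2023, Prop. 3.6 (l.1515–1528) and Def. 5.23 (l.1957–1960)] -/
theorem isNonsplitRubinLFunction_forall_of_exists_of_tendsto {P : DiscSeries p → Prop}
    {χ : ℕ → HeckeCharacter K} {n : ℕ → ℕ} {r : ℕ → FramedGaloisRep K (PadicAlgCl p) 1}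
    (hn : ∀ k, 2 * (p ^ 2 - 1) ∣ n k)
    (hunr : ∀ k (w : HeightOneSpectrum (𝓞 K)), ((p : ℕ) : 𝓞 K) ∉ w.asIdeal → (χ k).IsUnramifiedAt w)
    (hinf : ∀ k, (χ k).HasInfinityType (fun _ ↦ (n k : ℤ)) (fun _ ↦ -(n k : ℤ)))
    (hc : ∀ k, LFunction.HasEntireContinuation (heckeLFunction (ψ * χ k)))
    (hr : ∀ k, IsPAdicAvatarOf ι (χ k) (r k)) (hκ : ∀ k, FactorsThroughZp κac (r k))
    (hlim : Tendsto (fun k ↦ avatarValueAt (r k) γ) atTop (𝓝 1))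
    (hne : ∃ᶠ k in atTop, avatarValueAt (r k) γ ≠ 1)
    (hex : ∃ L, L.ConvergesOnBall ((p : ℝ) ^ (-(m : ℤ))) ∧
      IsNonsplitRubinLFunction ι κac γ ψ s₀ m C Ωinf Ωp L ∧ P L)
    {L' : DiscSeries p} (hconv' : L'.ConvergesOnBall ((p : ℝ) ^ (-(m : ℤ))))
    (hL' : IsNonsplitRubinLFunction ι κac γ ψ s₀ m C Ωinf Ωp L') : P L' := by
  obtain ⟨L, hconv, hL, hP⟩ := hex
  rwa [isNonsplitRubinLFunction_unique_of_tendsto hL hL' hconv hconv' hn hunr hinf hc hr hκ hlim hne]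
    at hP

end Frame

/-! ### §3. Prop \ref{Int} + Def \ref{pLf} at the trivial character `φ₀` (`X = 0`) -/

section Origin

variable {K : Type} [Field K] [NumberField K] {ι : PadicAlgCl p ≃+* ℂ} {κac : ZpExtension K p}
  {γ : absoluteGaloisGroup K} {ψ : HeckeCharacter K} {s₀ : ℂ} {m : ℕ}
  {C : ℕ → HeckeCharacter K → ℂ} {Ωinf : ℂ} {Ωp : ℂ_[p]} {L : DiscSeries p}

/-- The trivial Hecke character has infinity type `(0, 0)` (written with the casts the frame
produces at `k = 0`). [folklore] -/
theorem hasInfinityType_one_zero_cast :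
    (1 : HeckeCharacter K).HasInfinityType (fun _ ↦ ((0 : ℕ) : ℤ)) (fun _ ↦ -((0 : ℕ) : ℤ)) :=
  ⟨Set.univ, Filter.univ_mem, fun x _ => by simp [HeckeCharacter.archFactor_apply]⟩

omit [NumberField K] in
/-- The trivial avatar `e ∘ 1 : Γ_K → GL₁(ℚ̄_p)` factors through every `ℤ_p`-extension. [folklore] -/
theorem factorsThroughZp_trivialAvatar (κ : ZpExtension K p) :
    FactorsThroughZp κ ((FramedRep.unitsContinuousMulEquivOfUnique (Fin 1) (PadicAlgCl p) :
      (PadicAlgCl p)ˣ →ₜ* GL (Fin 1) (PadicAlgCl p)).comp 1) := by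
  intro σ _
  rw [ContinuousMonoidHom.comp_toFun]
  simp

omit [NumberField K] in
/-- The trivial avatar takes the value `1` at every `γ`, so its point is `X = r(γ) − 1 = 0` — the
origin `φ₀` of `Λ^{−,′}`. [folklore] -/
theorem avatarValueAt_trivialAvatar (γ : absoluteGaloisGroup K) :
    avatarValueAt ((FramedRep.unitsContinuousMulEquivOfUnique (Fin 1) (PadicAlgCl p) :
      (PadicAlgCl p)ˣ →ₜ* GL (Fin 1) (PadicAlgCl p)).comp 1) γ = 1 := by
  rw [avatarValueAt_unitsChar]
  simp

/-- Chosen entire continuations of EQUAL functions have equal values (`Exists.choose` on the same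
proposition). Used to pass between `L(ψ·𝟙, s)` and `L(ψ, s)`. [folklore] -/
theorem continuation_congr {f f' : ℂ → ℂ} (e : f = f') (h : LFunction.HasEntireContinuation f)
    (h' : LFunction.HasEntireContinuation f') : h.continuation = h'.continuation := by
  subst e
  rfl

/-- **Fan–Wan v2 Def 5.23 `\ref{pLf}` + Prop 3.6 `\ref{Int}` at `φ₀`, kernel form: "the origin
point `φ₀` IS an interpolation point — `k = 1`, `j = 0`" (l.1958).** If `L ∈ Λ^{−,′}` has the
interpolation property `IsNonsplitRubinLFunction ι κ⁻ γ ψ s₀ m C Ω_∞ Ω_p L`, then at the trivial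
character (`χ = 𝟙`, `k = 0`, trivial avatar, point `X = 0`) it takes the value
`ι⁻¹(C 0 𝟙 · L(ψ, s₀)/Ω_∞) · Ω_p`, where `L(ψ, s₀)` is read through the entire-continuation binder
of `L(ψ·𝟙, s)` exactly as the frame prescribes. Nothing is asserted about the existence of such `L`.
[claim: FanWan2023, status: under-review] [cite: FanWan2023, Def. 5.23 (l.1957–1960) and Prop. 3.6 (l.1515–1524)] -/
theorem hasValueAt_origin (hL : IsNonsplitRubinLFunction ι κac γ ψ s₀ m C Ωinf Ωp L)
    (hc : LFunction.HasEntireContinuation (heckeLFunction (ψ * 1))) :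
    L.HasValueAt 0 (((ι.symm (C 0 1 * hc.continuation s₀ / Ωinf)) : ℂ_[p]) * Ωp) := by
  have hx : ‖avatarValueAt ((FramedRep.unitsContinuousMulEquivOfUnique (Fin 1) (PadicAlgCl p) :
      (PadicAlgCl p)ˣ →ₜ* GL (Fin 1) (PadicAlgCl p)).comp 1) γ - 1‖ < (p : ℝ) ^ (-(m : ℤ)) := by
    rw [avatarValueAt_trivialAvatar, sub_self, norm_zero]
    exact zpow_pos (Nat.cast_pos.2 (Fact.out : p.Prime).pos) _
  have key := hL 1 0 (dvd_zero _) (fun w _ ↦ isUnramifiedAt_one' w) hasInfinityType_one_zero_cast hc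
    _ (isPAdicAvatarOf_one ι) (factorsThroughZp_trivialAvatar κac) hx
  simpa [avatarValueAt_trivialAvatar] using key

/-- **The constant term of an `IsNonsplitRubinLFunction`-witness is the algebraic part of the
central value**: `[X⁰]L = ι⁻¹(C 0 𝟙 · L(ψ, s₀)/Ω_∞) · Ω_p` (`L(φ₀) = [X⁰]L`,
`DiscSeries.hasValueAt_zero`, and uniqueness of `HasSum` limits).
[claim: FanWan2023, status: under-review] [cite: FanWan2023, Def. 5.23 (l.1957–1960) and Prop. 3.6 (l.1515–1524)] -/
theorem constantCoeff_eq_of_isNonsplitRubinLFunction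
    (hL : IsNonsplitRubinLFunction ι κac γ ψ s₀ m C Ωinf Ωp L)
    (hc : LFunction.HasEntireContinuation (heckeLFunction (ψ * 1))) :
    PowerSeries.constantCoeff L = ((ι.symm (C 0 1 * hc.continuation s₀ / Ωinf)) : ℂ_[p]) * Ωp :=
  HasSum.unique (DiscSeries.hasValueAt_zero L) (hasValueAt_origin hL hc)

/-- **`𝓛(φ₀) ≠ 0 ↔ L(ψ, s₀) ≠ 0`** for a witness of the frame, when the constant `C 0 𝟙` and the
periods `Ω_∞`, `Ω_p` are non-zero (FW: `C ≠ 0` under the test-vector condition of App. A; the CM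
periods are non-zero by construction, l.1478–1481). Here `L(ψ, s₀)` is the entire continuation of
the tree's `heckeLFunction ψ` (`hc₀`; its `ψ·𝟙`-avatar is produced inside). This is the kernel form
of the step "for the last identity we use `L(ξχ^c, 1) ≠ 0`" of the proof of Thm 6.9 (l.2219):
`ord_{(X)} 𝓛°_{ξχ^c} = 0`. [claim: FanWan2023, status: under-review]
[cite: FanWan2023, proof of Thm. 6.9 (l.2213–2220) with Def. 5.23 (l.1958)] -/
theorem constantCoeff_ne_zero_iff (hL : IsNonsplitRubinLFunction ι κac γ ψ s₀ m C Ωinf Ωp L)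
    (hc₀ : LFunction.HasEntireContinuation (heckeLFunction ψ)) (hC : C 0 1 ≠ 0) (hΩinf : Ωinf ≠ 0)
    (hΩp : Ωp ≠ 0) : PowerSeries.constantCoeff L ≠ 0 ↔ hc₀.continuation s₀ ≠ 0 := by
  have hc : LFunction.HasEntireContinuation (heckeLFunction (ψ * 1)) := by rwa [mul_one]
  have hcont : hc.continuation = hc₀.continuation := continuation_congr (by rw [mul_one]) hc hc₀
  rw [constantCoeff_eq_of_isNonsplitRubinLFunction hL hc, hcont, mul_ne_zero_iff, and_iff_left hΩp,
    ne_eq, UniformSpace.Completion.coe_eq_zero_iff, map_eq_zero_iff _ ι.symm.injective,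
    div_eq_zero_iff, not_or, and_iff_left hΩinf, mul_eq_zero, not_or, and_iff_right hC]

/-- **FW Thm 6.9, the typeable use of Prop \ref{Int}: `L(ψ', s₀) ≠ 0 ⟹ 𝓛°_{ψ'}(φ₀) ≠ 0`**
(`ord_{(X)} 𝓛°_{ξχ^c} = 0`, l.2219). This is the statement `stub_originNonvanishing` of the crux-A
skeleton `fw-ramified-tower` v2 (stmt-BirchSwinnertonDyer-19079). [claim: FanWan2023, status: under-review]
[cite: FanWan2023, proof of Thm. 6.9 (l.2213–2220) with Def. 5.23 (l.1958)] -/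
theorem constantCoeff_ne_zero_of_centralValue_ne_zero
    (hL : IsNonsplitRubinLFunction ι κac γ ψ s₀ m C Ωinf Ωp L)
    (hc₀ : LFunction.HasEntireContinuation (heckeLFunction ψ)) (hC : C 0 1 ≠ 0) (hΩinf : Ωinf ≠ 0)
    (hΩp : Ωp ≠ 0) (hval : hc₀.continuation s₀ ≠ 0) : PowerSeries.constantCoeff L ≠ 0 :=
  (constantCoeff_ne_zero_iff hL hc₀ hC hΩinf hΩp).2 hval

/-- **Sign `−1` shadow: `L(ψ, s₀) = 0 ⟹ 𝓛(φ₀) = 0`, i.e. `X ∣ 𝓛`** — for the root-number-`−1`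
character of Thm 6.9 itself the `p`-adic `L`-function vanishes at `φ₀` (no constant/period
hypothesis needed in this direction). [claim: FanWan2023, status: under-review]
[cite: FanWan2023, Def. 5.23 (l.1957–1960) and §6 standing hypothesis (l.2075)] -/
theorem constantCoeff_eq_zero_of_centralValue_eq_zero
    (hL : IsNonsplitRubinLFunction ι κac γ ψ s₀ m C Ωinf Ωp L)
    (hc₀ : LFunction.HasEntireContinuation (heckeLFunction ψ)) (hval : hc₀.continuation s₀ = 0) :
    PowerSeries.constantCoeff L = 0 := by
  have hc : LFunction.HasEntireContinuation (heckeLFunction (ψ * 1)) := by rwa [mul_one]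
  have hcont : hc.continuation = hc₀.continuation := continuation_congr (by rw [mul_one]) hc hc₀
  rw [constantCoeff_eq_of_isNonsplitRubinLFunction hL hc, hcont, hval, mul_zero, zero_div, map_zero,
    UniformSpace.Completion.coe_zero, zero_mul]

/-- `X ∣ 𝓛` form of the previous lemma: the power series is divisible by `X` when the central
value vanishes. [claim: FanWan2023, status: under-review]
[cite: FanWan2023, Def. 5.23 (l.1957–1960) and §6 standing hypothesis (l.2075)] -/
theorem X_dvd_of_centralValue_eq_zero
    (hL : IsNonsplitRubinLFunction ι κac γ ψ s₀ m C Ωinf Ωp L)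
    (hc₀ : LFunction.HasEntireContinuation (heckeLFunction ψ)) (hval : hc₀.continuation s₀ = 0) :
    (PowerSeries.X : DiscSeries p) ∣ L :=
  PowerSeries.X_dvd_iff.2 (constantCoeff_eq_zero_of_centralValue_eq_zero hL hc₀ hval)

end Origin

end Summit.BirchSwinnertonDyer.BirchSwinnertonDyer.Theorems.CongruentShaFreeCutPropIntAtOrigin

end
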